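import Summits.ResolutionOfSingularities.ResolutionOfSingularities.Theorems.AbsoluteQFrameCount
import Summits.ResolutionOfSingularities.ResolutionOfSingularities.Theorems.RegularCurveCut
import HarnessLib

/-!
# AbsoluteContactInsep — decomp-res node «AbsoluteContactInsep» (lens-6 g18), tree file 9/10 of the node

Content VERBATIM from the decomp-res lens-6 g18 file `HOME/decomp-res-lens-6/g18/AbsoluteContactInsep.lean` (sha256
3771488be5d3cd2c, 1966 l; HOME =
run/shared/lean/pub/decomp-res).  Critic: CRITIC-LEDGER row 139 (CLEARED 2026-08-30T20:11:48Z, DECIDED +1: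
`AbsContactOff3` proved for every p ≠ 3 and every
field, hypothesis-free); split per the lens's NODE-g18 §8 writer package (sections kept whole; two packages halved
for the 400-line limit).  Landed by
decomp-res writer g7 in the lens's namespace `…Theorems.AbsoluteContactClasses` (cone-free chain); the wiring
`Theorems/MaxContactCutAbsContactOff3`
(`agAbsContactOff3 : AGAbsContactOff3`, item 27752) follows the chain.  No new aside, nothing superseded; asides
31574 / 27753 / 27896 are ⟺ each other
hypothesis-free by this node.

Sections `Main` + `AllMarkings` + `Corollaries` (l. 1800–1964): `hasQFrames`, **`absContactOff3 :
AbsContactOff3`**, `isAbsContactAt_of_not_dvd` (absolute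
Diff_ℤ^{≤ n−1}-contact at every closed point of order n with p ∤ n, any field of char p), `closes18`, the
primed hypothesis-free iffs
`allHug3Off3_iff_noCurve'` / `off3Insep_iff_noCurve'` / `allHug3Off3_iff_hypHug3Insep'`.

[WRITER NOTE (decomp-res writer g7): file split only; namespace, opens, section variables and every declaration
exactly as in the lens (global `set_option` dropped).]

(Sources: Giraud1975; EGA IV 16.11.2, 0_IV 21.9; KimuraNiitsuma1980 Thm 3.4; EncinasVillamayor2000 Thm 4.9;
BravoGarciaEscamillaVillamayor2012 Lemma 4.6; Hironaka1964; CossartJannsenSaito2020; CossartPiltant2019; Kunz1969.)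
-/

noncomputable section

open CategoryTheory AlgebraicGeometry TopologicalSpace
open Literature.AlgebraicGeometry.Resolution
open Summit.ResolutionOfSingularities.ResolutionOfSingularities.Theorems
open WeakOrderReduction ForcedTowerClasses PurityValveClasses
open SatelliteExitClasses
open IsLocalRing MvPolynomial

namespace Summit.ResolutionOfSingularities.ResolutionOfSingularities.Theorems.AbsoluteContactClasses

section Main

/-! ## Part B — conclusion: `hasQFrames`, and the new lemma `absContactOff3` -/

/-- **`HasQFrames` holds**: every regular local ring essentially of finite type over a field `k` of
characteristic `p` with residue field finite over `k` has an absolute `p^e`-frame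
`Cq = R^{p^e}[b]` at every regular system of parameters (`b` = lifts of a `p`-basis of the residue
field adapted to `k`). [folklore] -/
theorem hasQFrames : HasQFrames := by
  intro p _ k _ _ R _ _ _ _ _ d u hd hu e he
  classical
  have hp : p.Prime := Fact.out
  obtain ⟨e', rfl⟩ : ∃ e', e = e' + 1 := ⟨e - 1, by omega⟩
  haveI : CharP R p := charP_of_injective_algebraMap (algebraMap k R).injective p
  haveI : CharP (ResidueField R) p :=
    charP_of_injective_algebraMap (algebraMap k (ResidueField R)).injective p
  have hκK : ∀ a : k, algebraMap k (ResidueField R) a = residue R (algebraMap k R a) := fun a => by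
    rw [IsScalarTower.algebraMap_apply k R (ResidueField R)]; rfl
  -- field layer: an adapted `p`-independent generating set `Λ ⊆ T` of the residue field
  obtain ⟨Λ, T, hΛk, hΛT, hTi, hTgen, hΛgen⟩ := exists_adapted_pIndependent p (K := ResidueField R) k
  -- lifts `b : T → R`, through `k` on `Λ`
  have hlift : ∀ ξ : ↥T, ∃ r : R, residue R r = ξ ∧
      ((ξ : ResidueField R) ∈ Λ → ∃ a : k, algebraMap k (ResidueField R) a = ξ ∧ r = algebraMap k R a) := by
    intro ξ
    by_cases hξ : (ξ : ResidueField R) ∈ Λ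
    · obtain ⟨a, ha⟩ := hΛk hξ
      exact ⟨algebraMap k R a, by rw [← hκK, ha], fun _ => ⟨a, ha, rfl⟩⟩
    · obtain ⟨r, hr⟩ := residue_surjective (R := R) ξ
      exact ⟨r, hr, fun h => absurd h hξ⟩
  choose b hb hbΛ using hlift
  have hbval : (fun i : ↥T => residue R (b i)) = Subtype.val := funext hb
  -- (i) independence of the residues
  have hT : QIndep (p ^ (e' + 1)) (fun i => residue R (b i)) := by
    rw [hbval]
    exact QIndep.pow_level p (qIndep_of_isPIndependent p hTi) (e' + 1)
  -- (ii) generation of the residue field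
  have hK : ∀ ξ : ResidueField R, ξ ∈ Subring.closure
      ((fun y : ResidueField R => y ^ p ^ (e' + 1)) '' Set.univ ∪ Set.range (fun i => residue R (b i))) := by
    rw [hbval, Subtype.range_coe]
    exact forall_mem_pcl_pow p T (fun x => mem_pcl_of_mem_adjoin p T (hTgen x)) (e' + 1) (Nat.succ_pos e')
  -- (iii) the coefficient field is finitely generated over `Sq`
  obtain ⟨M₁, hM₁⟩ := exists_finset_span_pcl p k hΛk hΛgen
  obtain ⟨M, hM⟩ := exists_finset_span_pcl_pow p k _ M₁ hM₁ e'
  have hΛ₀S : ∀ c ∈ pcl (p ^ (e' + 1)) ((algebraMap k (ResidueField R)) ⁻¹' Λ),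
      algebraMap k R c ∈ genSubring p (e' + 1) b u := by
    intro c hc
    refine (Subring.closure_le (t := (genSubring p (e' + 1) b u).comap (algebraMap k R))).mpr ?_ hc
    rintro x (⟨y, -, rfl⟩ | hx)
    · rw [SetLike.mem_coe, Subring.mem_comap, map_pow]; exact pow_mem_genSubring p (e' + 1) b u _
    · rw [SetLike.mem_coe, Subring.mem_comap]
      have hxT : algebraMap k (ResidueField R) x ∈ T := hΛT hx
      obtain ⟨a, ha, hba⟩ := hbΛ ⟨_, hxT⟩ hx
      have hax : a = x := (algebraMap k (ResidueField R)).injective ha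
      rw [← hax, ← hba]
      exact frobSubring_le_genSubring p (e' + 1) b u (apply_mem_frobSubring p (e' + 1) b ⟨_, hxT⟩)
  have hk : ∃ Mk : Finset R, ∀ a : k,
      algebraMap k R a ∈ Submodule.span (↥(genSubring p (e' + 1) b u)) (Mk : Set R) := by
    refine ⟨M.image (algebraMap k R), fun a => ?_⟩
    obtain ⟨f, -, hf⟩ := Submodule.mem_span_finset.mp (hM a)
    rw [← hf, map_sum]
    refine Submodule.sum_mem _ fun m hm => ?_
    rw [Subring.smul_def, smul_eq_mul, map_mul]
    have : algebraMap k R (f m : k) * algebraMap k R m =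
        (⟨algebraMap k R (f m : k), hΛ₀S _ (f m).2⟩ : ↥(genSubring p (e' + 1) b u)) • algebraMap k R m := rfl
    rw [this]
    exact Submodule.smul_mem _ _ (Submodule.subset_span (Finset.mem_coe.mpr (Finset.mem_image_of_mem _ hm)))
  exact ⟨frobSubring p (e' + 1) b, isQFrame_frobSubring p (e' + 1) b hd u hu k hT hK hk⟩

/-- **THE NEW LEMMA — inseparable residue fields included.** For `p ≠ 3`, ANY base field `k` of
characteristic `p`, `Y` regular of finite type over `k` (`IsBase`), a closed point `y` and an
ideal sheaf with `ord_y 𝓘 = 3`: some ABSOLUTE (`ℤ`-linear) differential operator of order `≤ 2`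
of `𝒪_{Y,y}` sends an element of `𝓘_y` into `𝔪_y ∖ 𝔪_y²`. Unconditional; closes the residual
hypothesis `hA : AbsContactOff3` of generation 17 (`absContactOff3_perfect`, `absContactOff3_sep`
were the known cases). [folklore] -/
theorem absContactOff3 : AbsContactOff3 := absContactOff3_of_hasQFrames hasQFrames

end Main

section AllMarkings

/-! ## Part C′ — the same lemma at EVERY marking prime to `p` (for lens 4's contact-free towers:
absolute contact can only fail at a closed point of order `n` when `p ∣ n`) -/

/-- **Absolute contact at every marking prime to the characteristic.** `p` prime, `p ∤ n`, `n ≥ 1`,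
ANY field `k` of characteristic `p`, `Y` an `IsBase` scheme over `k`, `y` closed, `ord_y 𝓘 = n`:
`y` is an absolute `Diff_ℤ^{≤ n-1}`-contact point of `𝓘` (`IsAbsContactAt 𝓘 n y`).  Same proof as
`absContactOff3` with an absolute `p^n`-frame (`n < p^n`). PROVED, 0 sorry. [folklore] -/
theorem isAbsContactAt_of_not_dvd {p : ℕ} (hp : p.Prime) {n : ℕ} (hn : 0 < n) (hpn : ¬ p ∣ n)
    {k : Type} [Field k] [CharP k p] (Y : Scheme.{0}) (g : Y ⟶ Spec (.of k)) (hB : IsBase Y g)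
    (I : Y.IdealSheafData) (y : Y) (hy : IsClosed ({y} : Set Y))
    (hord : idealOrder I y = ((n : ℕ) : ℕ∞)) : IsAbsContactAt I n y := by
  obtain ⟨N, rfl⟩ : ∃ N, n = N + 1 := ⟨n - 1, by omega⟩
  haveI : Fact p.Prime := ⟨hp⟩
  haveI : LocallyOfFiniteType g := hB.locallyOfFiniteType
  have hle : stalkIdeal I y ≤ maximalIdeal (Y.presheaf.stalk y) ^ (N + 1) :=
    (le_idealOrder_iff I y (N + 1)).mp hord.ge
  have hnle : ¬ stalkIdeal I y ≤ maximalIdeal (Y.presheaf.stalk y) ^ (N + 2) := by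
    intro h
    have h1 := (le_idealOrder_iff I y (N + 2)).mpr h
    rw [hord] at h1
    exact absurd (ENat.coe_le_coe.mp h1) (by omega)
  obtain ⟨h, hhI, hh2⟩ : ∃ h ∈ stalkIdeal I y, h ∉ maximalIdeal (Y.presheaf.stalk y) ^ (N + 2) := by
    by_contra hcon
    push Not at hcon
    exact hnle hcon
  have hh1 : h ∈ maximalIdeal (Y.presheaf.stalk y) ^ (N + 1) := hle hhI
  let R := (Spec (CommRingCat.of k)).presheaf.stalk (g y)
  let S := Y.presheaf.stalk y
  letI algRS : Algebra R S := (g.stalkMap y).hom.toAlgebra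
  letI algkR : Algebra k R := StructureSheaf.stalkAlgebra (↑(CommRingCat.of k)) (g y)
  haveI : IsLocalization.AtPrime R (g y).asIdeal :=
    StructureSheaf.IsLocalization.to_stalk (↑(CommRingCat.of k)) (g y)
  haveI : Algebra.EssFiniteType k R := Algebra.EssFiniteType.of_isLocalization R (g y).asIdeal.primeCompl
  letI algkS : Algebra k S := stalkAlgebra (g.appTop.hom.comp (Scheme.ΓSpecIso (.of k)).inv.hom) y
  haveI : IsScalarTower k R S :=
    IsScalarTower.of_algebraMap_eq' (stalkMap_comp_toStalk_eq_stalkHom g y).symm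
  haveI : Algebra.EssFiniteType R S := LocallyOfFiniteType.stalkMap g y
  haveI : Algebra.EssFiniteType k S := Algebra.EssFiniteType.comp k R S
  haveI : IsRegularLocalRing S := hB.isRegular y
  haveI : Module.Finite k (ResidueField S) := module_finite_residueField_of_isClosed g hy
  haveI : CharP S p := charP_of_injective_algebraMap (algebraMap k S).injective p
  obtain ⟨u, hu⟩ := exists_regularSystemOfParameters (R := S)
  obtain ⟨Cq, hF⟩ := hasQFrames p k S u rfl hu (N + 1) (Nat.succ_pos N)
  have hq : N + 1 < p ^ (N + 1) := Nat.lt_pow_self hp.one_lt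
  obtain ⟨D, hD, hm, hm2⟩ := exists_isDiffOpLE_of_isQFrame p (N + 1) hF rfl hu hq hh1 hh2 hpn
  refine ⟨D h, ?_, hm, hm2⟩
  rw [Nat.add_sub_cancel]
  exact apply_mem_diffIdeal ℤ hD hhI

/-- `AbsContactOff3` again, as the case `n = 3` of `isAbsContactAt_of_not_dvd`. [folklore] -/
theorem absContactOff3' : AbsContactOff3 := fun p hp hp3 k _ _ Y g hB I y hy hord =>
  isAbsContactAt_of_not_dvd hp (by norm_num)
    (fun hd => hp3 ((Nat.prime_dvd_prime_iff_eq hp Nat.prime_three).mp hd)) Y g hB I y hy hord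

end AllMarkings

section Corollaries

/-! ## Part C — hypothesis-free corollaries (the g17 cut loses its hypothesis `hA : AbsContactOff3`) -/

/-- **`closes18`** — the aside `AllHug3Off3` from the located no-curve residual ALONE (g17's
`closes17` with `hA : AbsContactOff3` discharged by `absContactOff3`). PROVED. [folklore] -/
theorem closes18 (hN : HypHug3InsepNoCurve) : AllHug3Off3 := closes17 absContactOff3 hN

/-- `AllHug3Off3Imp` from the no-curve residual alone. PROVED. [folklore] -/
theorem closes18_imp (hN : HypHug3InsepNoCurve) : AllHug3Off3Imp := closes17_imp absContactOff3 hN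

/-- **EXACTNESS, hypothesis-free**: the located no-curve residual IS g15's residue-inseparable cell. [folklore] -/
theorem off3Insep_iff_noCurve' : Off3Insep ↔ HypHug3InsepNoCurve := off3Insep_iff_noCurve absContactOff3

/-- **EXACTNESS, hypothesis-free**: the located no-curve residual IS the whole aside `AllHug3Off3`. [folklore] -/
theorem allHug3Off3_iff_noCurve' : AllHug3Off3 ↔ HypHug3InsepNoCurve := allHug3Off3_iff_noCurve absContactOff3

/-- **EXACTNESS, hypothesis-free** (`Imp` form of the aside). [folklore] -/
theorem allHug3Off3Imp_iff_noCurve' : AllHug3Off3Imp ↔ HypHug3InsepNoCurve :=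
  allHug3Off3Imp_iff_noCurve absContactOff3

/-- **EXACTNESS, hypothesis-free**: the located residual `HypHug3Insep` (g15) IS the aside. [folklore] -/
theorem allHug3Off3_iff_hypHug3Insep' : AllHug3Off3 ↔ HypHug3Insep :=
  allHug3Off3_iff_noCurve'.trans hypHug3Insep_iff_noCurve.symm

/-- the sufficient re-target now closes the aside on its own. PROVED. [folklore] -/
theorem closes18' (hC : HypCurve3Insep) : AllHug3Off3 := closes17' absContactOff3 hC

end Corollaries

end Summit.ResolutionOfSingularities.ResolutionOfSingularities.Theorems.AbsoluteContactClasses
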